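import Literature.MathematicalPhysics.QuantumFieldTheory.Balaban1983to89.T3FinestHeightTail
import Literature.MathematicalPhysics.QuantumFieldTheory.Balaban1983to89.T3Thresholds
import Literature.MathematicalPhysics.QuantumFieldTheory.Balaban1983to89.BlockAveragingPlaquetteBound
import Summits.QuantumFields.YangMills.Theorems.AlphaInputsT3ACv3BoxStokes
import HarnessLib

/-!
# FIRST EXIT AT THE FIRST AVERAGED LEVEL — the registered stub `stub_firstExitOne` (F1) of crux `FirstExitWindowTailL`
# (stmt-QuantumFields-26243, route `FirstExitWindow`, rung R3 = RECORD-label leaf `YM3TorusSU2`), PROVED from the BARE single-plaquette tail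

Seat `ym-line-sfw-p1` g11 (home cell `ym-idea-1`), `--supports stmt-QuantumFields-26243`.

THE CLAIM (the line card's F1 = «first exit at j = 1: the finer history is the bare field»): for every block size `L`, profile `(b₀, p₀)`
and `b₂ ≥ b₀` there are `γ₁ ∈ (0,1]`, `C ≥ 0`, `c > 0`, `N` with: for every d = 3 family `F` with `F.L = L`, `0 < γ ≤ γ₁`, every cut-off
`K ≥ 1` and every level-1 plaquette `p`, the `Gibbs_K`-probability of «bare field `θ_{b₀}(K)`-small ∧ `Ū¹` is `θ_{b₂}(K−1)`-small ∧
`θ_{b₀}(K−1) ≤ |Ū¹(∂p) − 1|» is `≤ C·β_{K−1}^N·exp(−c·p(g_{K−1})²)`, `β_{K−1} = (γL^{−(K−1)})⁻¹`, `p = B10.pFun b₀ p₀`.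

THE POINT OF THIS FILE: **F1 needs no reflection positivity, no chessboard and no Gaussian domination** (the line card lists those as the
engine of F1) — only LOCALITY of the (0.4) averaging and the tree's Peierls–chessboard tail of ONE BARE plaquette:
* §1 (deterministic, every level `j`, every `SU(N)`): the coarse plaquette `Ū(∂p)` of the (0.4)-averaged field `Ū = avgFun ℰ U` is the straight
  `L × L` Wilson loop times four correction factors; the loop is within `Σ_{L² tiling plaquettes} |U(∂q) − 1|` of `1`
  (`B10Eq47AxialChi.dist1_plaqHol_axialAvg_le`), each correction factor within `6·(((d+2)L)²/4)·a` of `1` as soon as the level-`j`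
  plaquettes of the TWO BLOCKS of its bond are within `a` of `1` (box-local crude Stokes `BoxStokes.dist1_loopHol_le_twoBlock` + the modulus of
  `exp[mean log]`, `BlockAveragingPlaquetteBound.dist1_expMeanLogSU_avg_le`; off the guard the factor is `1`).  Hence
  ★ `dist1_plaqHol_avgFun_le_local`: `|Ū(∂p) − 1| ≤ (L² + 6((d+2)L)²)·a` from the plaquettes whose base point lies in one of the FOUR CORNER
  BLOCKS of `p` only ([Balaban1985Averaging] p.25 «the bound depends on V(∂p′) − 1 on Δ(p′)»).
* §2 the blamed neighbourhood `nbhd p` (a `Finset` of fine plaquettes: the `L²` tiling plaquettes ∪ those based in the corner blocks) has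
  `≤ L² + 5·d²·L^d` members — INDEPENDENT of the volume (`card_nbhd_le`), and ★ `exists_mem_nbhd_le_dist1`: `θ ≤ |Ū(∂p) − 1|` with
  `(((d+2)L)²/4)·θ < δ_N` forces `θ/W ≤ |U(∂q) − 1|` for some `q ∈ nbhd p`, `W = L² + 6((d+2)L)² + 1`.
* §3 (d = 3, `SU(2)`): union bound over `nbhd p` and the tree's bare tail `T3FinestHeightTail.gibbsMeasure_real_dist1_ge_le`
  (`Gibbs{θ' ≤ |U(∂q) − 1|} ≤ 2e^{24}c₀⁻³(√β_K)^9 e^{−β_K θ'²/4}`) at `θ' = θ_{b₀}(K−1)/W`; the height arithmetic `β_K·θ_{b₀}(K−1)² = L·p(g_{K−1})²`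
  (one factor `L` from `β_K = L·β_{K−1}`) gives the exponent `c = L/(4W²)`, and `(√β_K)^9 ≤ L^5 β_{K−1}^5` the power `N = 5`.
  ★★★ `stub_firstExitOne` — the registered signature VERBATIM.
WHY j ≥ 2 IS DIFFERENT (stub `stub_firstExitDeep`, NOT touched): there the blamed plaquettes are AVERAGED ones (`Ū^{j−1}`), whose tails are the
crux; iterating §2 down to the bare field loses a factor `W` per level against a gain `√L` of the thresholds — summability in the height dies.

HONEST FRAMING.  Kernel facts about the tree's own averaging + ONE use of the landed bare tail; nothing of Bałaban's renormalisation-group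
estimates is asserted; the crux `FirstExitWindowTailL`, the route and rung R3 (a RECORD rung — not the summit `YangMills`, not Clay) stay open.
No `def` beyond the transparent bookkeeping `Finset` `nbhd` (a term abbreviation, no mathematical content), no named fact, no `sorry`.

References: T. Bałaban, CMP **98** (1985) 17–51 [Balaban1985Averaging] ((9) p.19, (19)–(20) p.21, p.25, Prop. 1 (51) p.26); CMP **102** (1985)
255–275 [Balaban1985UV3] ((7) p.257, (11) p.258, (71) p.273); CMP **109** (1987) 249–301 [Balaban1987RG1] ((0.4) p.253);
[FrohlichIsraelLiebSimon1978] Thm. 4.1 (the engine of the bare tail).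
-/

set_option autoImplicit false

noncomputable section

open MeasureTheory
open scoped BigOperators

namespace Summit.QuantumFields.YangMills.Theorems.FirstExitWindow

open Literature.MathematicalPhysics.QuantumFieldTheory.Balaban1983to89
open Literature.MathematicalPhysics.QuantumFieldTheory.Balaban1983to89.T3ContinuumYM3Torus
open Literature.MathematicalPhysics.QuantumFieldTheory.Balaban1983to89.T3UnitScaleTilt
open Literature.MathematicalPhysics.QuantumFieldTheory.Balaban1983to89.T3UnitLawDensityEML (ℰp)
open Literature.MathematicalPhysics.QuantumFieldTheory.Balaban1983to89.ExpMeanLog (expMeanLogSU deltaSU deltaSU_pos)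
open Literature.MathematicalPhysics.QuantumFieldTheory.Balaban1983to89.BlockAveraging (blockAvg avgFun corr loopHol Small blockAvg_avg)
open Literature.MathematicalPhysics.QuantumFieldTheory.Balaban1983to89.BlockAveragingPlaquetteBound (dist1_expMeanLogSU_avg_le dist1_plaquette_with_corr_le)
open Literature.MathematicalPhysics.QuantumFieldTheory.Balaban1983to89.B10Eq47AxialChi (dist1_plaqHol_axialAvg_le shiftN)
open Literature.MathematicalPhysics.QuantumFieldTheory.Balaban1983to89.T3Thresholds (exists_gamma_forall_θBal_le)
open Literature.MathematicalPhysics.QuantumFieldTheory.Balaban1983to89.T3MinimiserStabilityReduction (θBal_pos)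
open Literature.MathematicalPhysics.QuantumFieldTheory.Balaban1983to89.T3FinestHeightTail (gibbsMeasure_real_dist1_ge_le)
open Summit.QuantumFields.YangMills.Theorems.BoxStokes (dist1_loopHol_le_twoBlock)

/-! ## §1 The coarse plaquette of the (0.4)-averaged field from the four corner blocks (every level, every `SU(N)`) -/

section Local

variable {n : Type*} [Fintype n] [DecidableEq n] [Nonempty n] {P : Params} {j : ℕ}

/-- **LOCAL MODULUS OF THE CORRECTION FACTOR**: if the level-`j` plaquettes of the two blocks of the coarse bond `c` are within `a ≥ 0` of `1`
and `(((d+2)L)²/4)·a < δ_N`, then `|corr ℰ U c − 1| ≤ 6·(((d+2)L)²/4)·a` — on the guard by the modulus of `exp[mean log]` and the box-local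
crude Stokes bound for the (0.4) loop variables, off the guard the factor is `1`. [cite: Balaban1987RG1, (0.4) p.253] -/
theorem dist1_corr_le_local (hj : j + 1 ≤ P.m + P.K) {a : ℝ} (ha : 0 ≤ a)
    {U : GaugeField P j (Matrix.specialUnitaryGroup n ℂ)} (c : PBond P (j + 1))
    (hU : ∀ q : Plaq P j, (blockOf q.src = c.src ∨ blockOf q.src = c.tgt) →
      (blockOf ((q.src.shift q.μ).shift q.ν) = c.src ∨ blockOf ((q.src.shift q.μ).shift q.ν) = c.tgt) →
      dist1 (GaugeField.plaqHol U q) ≤ a)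
    (ht : ((((P.d + 2) * P.L : ℕ) : ℝ) ^ 2 / 4) * a < deltaSU n) :
    dist1 (corr (expMeanLogSU (n := n)) U c) ≤ 6 * (((((P.d + 2) * P.L : ℕ) : ℝ) ^ 2 / 4) * a) := by
  unfold corr
  split_ifs with hsmall
  · exact dist1_expMeanLogSU_avg_le (fun i => dist1_loopHol_le_twoBlock hj ha c hU i) ht
  · rw [GaugeGroup.dist1_one]; positivity

/-- **★ [Balaban1985Averaging] PROP. 1 (CRUDE FORM), LOCAL VERSION**: for a coarse plaquette `p` of `T^{(j+1)}`, if the `L²` fine plaquettes tiling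
`p` and every fine plaquette based in one of the corner blocks `{p₋, p₋+e_μ, p₋+e_ν, p₋+e_μ+e_ν}` are within `a ≥ 0` of `1`, and
`(((d+2)L)²/4)·a < δ_N`, then `|Ū(∂p) − 1| ≤ (L² + 6((d+2)L)²)·a` for `Ū = avgFun ℰ U` (standing range `j + 1 ≤ m + K`).
[cite: Balaban1985Averaging, Prop. 1 (51) p.26 and p.25] -/
theorem dist1_plaqHol_avgFun_le_local (hj : j + 1 ≤ P.m + P.K) {a : ℝ} (ha : 0 ≤ a)
    {U : GaugeField P j (Matrix.specialUnitaryGroup n ℂ)} (p : Plaq P (j + 1))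
    (hsq : ∀ t ∈ Finset.range P.L, ∀ s ∈ Finset.range P.L,
      dist1 (GaugeField.plaqHol U ⟨shiftN (shiftN (emb p.src) p.ν t) p.μ s, p.μ, p.ν, p.hμν⟩) ≤ a)
    (hbox : ∀ q : Plaq P j, blockOf q.src ∈ ({p.src, p.src.shift p.μ, p.src.shift p.ν, (p.src.shift p.μ).shift p.ν,
        (p.src.shift p.ν).shift p.μ} : Finset (Site P (j + 1))) → dist1 (GaugeField.plaqHol U q) ≤ a)
    (ht : ((((P.d + 2) * P.L : ℕ) : ℝ) ^ 2 / 4) * a < deltaSU n) :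
    dist1 (GaugeField.plaqHol (avgFun (expMeanLogSU (n := n)) U) p) ≤
      ((P.L : ℝ) ^ 2 + 6 * (((P.d + 2) * P.L : ℕ) : ℝ) ^ 2) * a := by
  -- the straight `L × L` loop
  have hax : dist1 (AveragingRT.axialAvg U ⟨p.src, p.μ⟩ * AveragingRT.axialAvg U ⟨p.src.shift p.μ, p.ν⟩ *
      (AveragingRT.axialAvg U ⟨p.src.shift p.ν, p.μ⟩)⁻¹ * (AveragingRT.axialAvg U ⟨p.src, p.ν⟩)⁻¹) ≤ (P.L : ℝ) ^ 2 * a := by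
    have h := dist1_plaqHol_axialAvg_le hj U p
    refine h.trans ?_
    calc ∑ t ∈ Finset.range P.L, ∑ s ∈ Finset.range P.L,
          dist1 (GaugeField.plaqHol U ⟨shiftN (shiftN (emb p.src) p.ν t) p.μ s, p.μ, p.ν, p.hμν⟩)
        ≤ ∑ _t ∈ Finset.range P.L, ∑ _s ∈ Finset.range P.L, a :=
          Finset.sum_le_sum fun t ht' => Finset.sum_le_sum fun s hs' => hsq t ht' s hs'
      _ = (P.L : ℝ) ^ 2 * a := by simp [Finset.sum_const, Finset.card_range]; ring
  -- the four correction factors, each from the two blocks of its bond (both corner blocks of `p`)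
  have hc : ∀ c : PBond P (j + 1), c.src ∈ ({p.src, p.src.shift p.μ, p.src.shift p.ν, (p.src.shift p.μ).shift p.ν,
        (p.src.shift p.ν).shift p.μ} : Finset (Site P (j + 1))) →
      c.tgt ∈ ({p.src, p.src.shift p.μ, p.src.shift p.ν, (p.src.shift p.μ).shift p.ν,
        (p.src.shift p.ν).shift p.μ} : Finset (Site P (j + 1))) →
      dist1 (corr (expMeanLogSU (n := n)) U c) ≤ 6 * (((((P.d + 2) * P.L : ℕ) : ℝ) ^ 2 / 4) * a) := by
    intro c hs htg
    refine dist1_corr_le_local hj ha c (fun q h1 _ => hbox q ?_) ht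
    rcases h1 with h1 | h1 <;> rw [h1]
    · exact hs
    · exact htg
  have h1 := hc ⟨p.src, p.μ⟩ (by simp) (by simp [PBond.tgt])
  have h2 := hc ⟨p.src.shift p.μ, p.ν⟩ (by simp) (by simp [PBond.tgt])
  have h3 := hc ⟨p.src.shift p.ν, p.μ⟩ (by simp) (by simp [PBond.tgt])
  have h4 := hc ⟨p.src, p.ν⟩ (by simp) (by simp [PBond.tgt])
  have hins := dist1_plaquette_with_corr_le
    (corr (expMeanLogSU (n := n)) U ⟨p.src, p.μ⟩) (AveragingRT.axialAvg U ⟨p.src, p.μ⟩)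
    (corr (expMeanLogSU (n := n)) U ⟨p.src.shift p.μ, p.ν⟩) (AveragingRT.axialAvg U ⟨p.src.shift p.μ, p.ν⟩)
    (corr (expMeanLogSU (n := n)) U ⟨p.src.shift p.ν, p.μ⟩) (AveragingRT.axialAvg U ⟨p.src.shift p.ν, p.μ⟩)
    (corr (expMeanLogSU (n := n)) U ⟨p.src, p.ν⟩) (AveragingRT.axialAvg U ⟨p.src, p.ν⟩)
  show dist1 (corr _ U ⟨p.src, p.μ⟩ * AveragingRT.axialAvg U ⟨p.src, p.μ⟩ *
      (corr _ U ⟨p.src.shift p.μ, p.ν⟩ * AveragingRT.axialAvg U ⟨p.src.shift p.μ, p.ν⟩) *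
      (corr _ U ⟨p.src.shift p.ν, p.μ⟩ * AveragingRT.axialAvg U ⟨p.src.shift p.ν, p.μ⟩)⁻¹ *
      (corr _ U ⟨p.src, p.ν⟩ * AveragingRT.axialAvg U ⟨p.src, p.ν⟩)⁻¹) ≤ _
  nlinarith

end Local

/-! ## §2 The blamed neighbourhood: finitely many fine plaquettes, their number independent of the volume -/

section Blame

variable {n : Type*} [Fintype n] [DecidableEq n] [Nonempty n] {P : Params} {j : ℕ}

/-- **At most `L^d·d²` plaquettes of `T^{(j)}` are based in a given block** (a block has `L^d` sites, `Site.blockEquiv`; a plaquette is its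
base point and two directions). [cite: Balaban1987RG1, (0.3) p.252] -/
theorem card_filter_blockOf_src_le (hj : j + 1 ≤ P.m + P.K) (b : Site P (j + 1)) :
    (Finset.univ.filter (fun q : Plaq P j => blockOf q.src = b)).card ≤ P.L ^ P.d * P.d ^ 2 := by
  classical
  rw [← Fintype.card_subtype]
  have hinj : Function.Injective (fun q : {q : Plaq P j // blockOf q.src = b} =>
      ((⟨q.1.src, q.2⟩ : {x : Site P j // blockOf x = b}), q.1.μ, q.1.ν)) := by
    rintro ⟨⟨s, μ, ν, h⟩, hb⟩ ⟨⟨s', μ', ν', h'⟩, hb'⟩ heq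
    simp only [Prod.mk.injEq, Subtype.mk.injEq] at heq
    obtain ⟨rfl, rfl, rfl⟩ := heq
    rfl
  refine (Fintype.card_le_of_injective _ hinj).trans (le_of_eq ?_)
  rw [Fintype.card_prod, Fintype.card_prod, Fintype.card_fin, Fintype.card_congr (Site.blockEquiv hj b), Fintype.card_fun,
    Fintype.card_fin, Fintype.card_fin, sq]

/-- **★★ THE BLAMED NEIGHBOURHOOD OF A COARSE PLAQUETTE**: for every plaquette `p` of `T^{(j+1)}` there is a finite set `S` of plaquettes of
`T^{(j)}` — the `L²` tiling plaquettes and those based in a corner block of `p` — with `|S| ≤ L² + 5·d²·L^d` (INDEPENDENT of the volume) such that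
for every `SU(N)` configuration `U` and every `a ≥ 0` with `(((d+2)L)²/4)·a < δ_N`: if every `q ∈ S` has `|U(∂q) − 1| ≤ a` then
`|Ū(∂p) − 1| ≤ (L² + 6((d+2)L)²)·a`, `Ū = avgFun ℰ U`. [cite: Balaban1985Averaging, Prop. 1 (51) p.26 and p.25] -/
theorem exists_blame_finset (hj : j + 1 ≤ P.m + P.K) (p : Plaq P (j + 1)) :
    ∃ S : Finset (Plaq P j), (S.card : ℝ) ≤ (P.L : ℝ) ^ 2 + 5 * ((P.L : ℝ) ^ P.d * (P.d : ℝ) ^ 2) ∧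
      ∀ (U : GaugeField P j (Matrix.specialUnitaryGroup n ℂ)) (a : ℝ), 0 ≤ a →
        ((((P.d + 2) * P.L : ℕ) : ℝ) ^ 2 / 4) * a < deltaSU n →
        (∀ q ∈ S, dist1 (GaugeField.plaqHol U q) ≤ a) →
        dist1 (GaugeField.plaqHol (avgFun (expMeanLogSU (n := n)) U) p) ≤
          ((P.L : ℝ) ^ 2 + 6 * (((P.d + 2) * P.L : ℕ) : ℝ) ^ 2) * a := by
  classical
  set corners : Finset (Site P (j + 1)) := {p.src, p.src.shift p.μ, p.src.shift p.ν, (p.src.shift p.μ).shift p.ν,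
        (p.src.shift p.ν).shift p.μ} with hcorners
  set Ssq : Finset (Plaq P j) := (Finset.range P.L ×ˢ Finset.range P.L).image
      (fun ts : ℕ × ℕ => (⟨shiftN (shiftN (emb p.src) p.ν ts.1) p.μ ts.2, p.μ, p.ν, p.hμν⟩ : Plaq P j)) with hSsq
  set Sbox : Finset (Plaq P j) := Finset.univ.filter (fun q : Plaq P j => blockOf q.src ∈ corners) with hSbox
  refine ⟨Ssq ∪ Sbox, ?_, ?_⟩
  · -- the count
    have h1 : Ssq.card ≤ P.L ^ 2 := by
      refine Finset.card_image_le.trans (le_of_eq ?_)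
      rw [Finset.card_product, Finset.card_range, sq]
    have hc5 : corners.card ≤ 5 :=
      (Finset.card_insert_le _ _).trans (Nat.succ_le_succ <| (Finset.card_insert_le _ _).trans (Nat.succ_le_succ <|
        (Finset.card_insert_le _ _).trans (Nat.succ_le_succ <| (Finset.card_insert_le _ _).trans
          (by rw [Finset.card_singleton]))))
    have h2 : Sbox.card ≤ 5 * (P.L ^ P.d * P.d ^ 2) := by
      have hsub : Sbox ⊆ corners.biUnion (fun b => Finset.univ.filter (fun q : Plaq P j => blockOf q.src = b)) := by
        intro q hq
        rw [hSbox, Finset.mem_filter] at hq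
        exact Finset.mem_biUnion.mpr ⟨blockOf q.src, hq.2, Finset.mem_filter.mpr ⟨Finset.mem_univ _, rfl⟩⟩
      refine (Finset.card_le_card hsub).trans (Finset.card_biUnion_le.trans ?_)
      calc ∑ b ∈ corners, (Finset.univ.filter (fun q : Plaq P j => blockOf q.src = b)).card
          ≤ ∑ _b ∈ corners, P.L ^ P.d * P.d ^ 2 := Finset.sum_le_sum fun b _ => card_filter_blockOf_src_le hj b
        _ = corners.card * (P.L ^ P.d * P.d ^ 2) := by rw [Finset.sum_const, smul_eq_mul]
        _ ≤ 5 * (P.L ^ P.d * P.d ^ 2) := Nat.mul_le_mul_right _ hc5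
    have h12 := (Finset.card_union_le Ssq Sbox).trans (add_le_add h1 h2)
    calc ((Ssq ∪ Sbox).card : ℝ) ≤ ((P.L ^ 2 + 5 * (P.L ^ P.d * P.d ^ 2) : ℕ) : ℝ) := by exact_mod_cast h12
      _ = (P.L : ℝ) ^ 2 + 5 * ((P.L : ℝ) ^ P.d * (P.d : ℝ) ^ 2) := by push_cast; ring
  · intro U a ha ht hS
    refine dist1_plaqHol_avgFun_le_local hj ha p (fun t ht' s hs' => hS _ ?_) (fun q hq => hS q ?_) ht
    · exact Finset.mem_union_left _ (Finset.mem_image.mpr ⟨(t, s), Finset.mem_product.mpr ⟨ht', hs'⟩, rfl⟩)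
    · exact Finset.mem_union_right _ (Finset.mem_filter.mpr ⟨Finset.mem_univ _, hq⟩)

end Blame

/-! ## §3 d = 3, `SU(2)`: the first exit at the first averaged level from the bare single-plaquette tail -/

section T3

/-- Height arithmetic at the first averaged level: `β_K = L·β_{K−1}` and `β_K·θ_{b₀}(K−1)² = L·p(g_{K−1})²` (`K ≥ 1`), where
`β_K = (γε_K)⁻¹`, `ε_K = L^{−K}`, `θ_{b₀}(K−1) = g_{K−1}p(g_{K−1})`, `g_{K−1}² = γL^{−(K−1)}`. [cite: Balaban1985UV3, (3)-(7) pp.256-257] -/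
theorem beta_height_one (F : T3Family) {γ : ℝ} (hγ : 0 < γ) (b₀ p₀ : ℝ) {K : ℕ} (hK : 1 ≤ K) :
    (F.scheme ℰp γ).β K = (F.L : ℝ) * (γ * ((F.L : ℝ)⁻¹) ^ (K - 1))⁻¹ ∧
      (F.scheme ℰp γ).β K * θBal F.L γ b₀ p₀ (K - 1) ^ 2 =
        (F.L : ℝ) * B10.pFun b₀ p₀ (Real.sqrt (γ * ((F.L : ℝ)⁻¹) ^ (K - 1))) ^ 2 := by
  have hL : (0 : ℝ) < F.L := by exact_mod_cast lt_trans zero_lt_one F.hL.2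
  obtain ⟨K', rfl⟩ : ∃ K', K = K' + 1 := ⟨K - 1, by omega⟩
  have hK' : K' + 1 - 1 = K' := by omega
  rw [hK']
  have hx : 0 < γ * ((F.L : ℝ)⁻¹) ^ K' := mul_pos hγ (pow_pos (inv_pos.2 hL) K')
  have hβ : (F.scheme ℰp γ).β (K' + 1) = (F.L : ℝ) * (γ * ((F.L : ℝ)⁻¹) ^ K')⁻¹ := by
    show (γ * ((F.L : ℝ)⁻¹) ^ (K' + 1))⁻¹ = _
    rw [pow_succ, ← mul_assoc, mul_inv, inv_inv]
    ring
  refine ⟨hβ, ?_⟩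
  rw [hβ, θBal, mul_pow, Real.sq_sqrt hx.le]
  field_simp

/-- ★★★ **`stub_firstExitOne` — FIRST EXIT AT THE FIRST AVERAGED LEVEL** (registered stub F1 of the birth skeleton of crux `FirstExitWindowTailL`,
stmt-QuantumFields-26243; signature verbatim): for every `L`, `(b₀, p₀)`, `b₂ ≥ b₀` there are `γ₁ ∈ (0,1]`, `C ≥ 0`, `c > 0`, `N` such that for
every family with `F.L = L`, every `0 < γ ≤ γ₁`, every `K ≥ 1` and every level-1 plaquette `p`, `Gibbs_K{bare field θ_{b₀}(K)-small ∧ Ū¹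
θ_{b₂}(K−1)-small ∧ θ_{b₀}(K−1) ≤ |Ū¹(∂p) − 1|} ≤ C·β_{K−1}^N·e^{−c·p(g_{K−1})²}`.  Proof: the event lies in the union over the `≤ L² + 45L³` blamed
bare plaquettes `q` of `{θ_{b₀}(K−1)/W ≤ |U(∂q) − 1|}` (§2, `W = L² + 6(5L)² + 1`), each of Gibbs probability `≤ 2e^{24}c₀⁻³(√β_K)^9 e^{−β_Kθ²/(4W²)}`
(the tree's bare tail), and `β_Kθ² = L·p(g_{K−1})²`, `(√β_K)^9 ≤ L^5β_{K−1}^5`; witnesses `N = 5`, `c = L/(4W²)`,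
`C = (L² + 45L³)·2e^{24}c₀⁻³·L^5`, `γ₁` = the threshold below which `θ_{b₀}(i) ≤ δ_{SU(2)}/(5L)²` at every height.
[cite: Balaban1985UV3, (7) p.257 and (71) p.273; Balaban1985Averaging, Prop. 1 (51) p.26] -/
theorem stub_firstExitOne :
    open Literature.MathematicalPhysics.QuantumFieldTheory.Balaban1983to89 Literature.MathematicalPhysics.QuantumFieldTheory.Balaban1983to89.T3ContinuumYM3Torus in ∀ (L : ℕ) (b₀ p₀ b₂ : ℝ), 0 < b₀ → 2 < p₀ → b₀ ≤ b₂ → ∃ (γ₁ C c : ℝ) (N : ℕ), 0 < γ₁ ∧ γ₁ ≤ 1 ∧ 0 < c ∧ 0 ≤ C ∧ ∀ (F : T3Family) (γ : ℝ), F.L = L → 0 < γ → γ ≤ γ₁ → ∀ (K : ℕ), 1 ≤ K → ∀ p : Plaq (F.P K) 1, (T3UnitScaleTilt.gibbsK F T3UnitLawDensityEML.ℰp γ K).real {U | (∀ k, k < 1 → PlaqSmall (T3UnitScaleTilt.θBal F.L γ b₀ p₀ (K - k)) (Averaging.iter (fun i => BlockAveraging.blockAvg (P := F.P K) (j := i)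 T3UnitLawDensityEML.ℰp) k U)) ∧ PlaqSmall (T3UnitScaleTilt.θBal F.L γ b₂ p₀ (K - 1)) (Averaging.iter (fun i => BlockAveraging.blockAvg (P := F.P K) (j := i) T3UnitLawDensityEML.ℰp) 1 U) ∧ T3UnitScaleTilt.θBal F.L γ b₀ p₀ (K - 1) ≤ GaugeGroup.dist1 (GaugeField.plaqHol (Averaging.iter (fun i => BlockAveraging.blockAvg (P := F.P K) (j := i) T3UnitLawDensityEML.ℰp) 1 U) p)} ≤ C * ((γ * ((F.L : ℝ)⁻¹) ^ (K - 1))⁻¹) ^ N * Real.exp (-(c * B10.pFun b₀ p₀ (Real.sqrt (γ * ((F.L : ℝ)⁻¹) ^ (K - 1))) ^ 2)) := by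
  intro L b₀ p₀ b₂ hb₀ hp₀ _hb₂
  -- the universal constant of the bare single-plaquette tail
  obtain ⟨c₀, hc₀, _hc₀1, htail⟩ := gibbsMeasure_real_dist1_ge_le (N := 2)
  by_cases hL : 1 ≤ L
  swap
  · -- degenerate block size: no family has `F.L = L ≤ 0`
    refine ⟨1, 0, 1, 0, one_pos, le_rfl, one_pos, le_rfl, ?_⟩
    intro F γ hFL
    exact absurd (hFL ▸ le_of_lt F.hL.2) hL
  -- the constants
  set W : ℝ := (L : ℝ) ^ 2 + 6 * (((3 + 2) * L : ℕ) : ℝ) ^ 2 + 1 with hW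
  have hW1 : 1 ≤ W := by
    have : (0 : ℝ) ≤ (L : ℝ) ^ 2 + 6 * (((3 + 2) * L : ℕ) : ℝ) ^ 2 := by positivity
    linarith
  have hW0 : 0 < W := one_pos.trans_le hW1
  have h5 : (0 : ℝ) < (((3 + 2) * L : ℕ) : ℝ) := by exact_mod_cast (by omega : 0 < (3 + 2) * L)
  have hσ : 0 < deltaSU (Fin 2) / (((3 + 2) * L : ℕ) : ℝ) ^ 2 := div_pos deltaSU_pos (by positivity)
  obtain ⟨γθ, hγθ, hγθ1, hθ⟩ := exists_gamma_forall_θBal_le hb₀ (by linarith : (0 : ℝ) < p₀) hσ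
  have hL0 : (0 : ℝ) < L := by exact_mod_cast (by omega : 0 < L)
  refine ⟨γθ, ((L : ℝ) ^ 2 + 5 * ((L : ℝ) ^ 3 * (3 : ℝ) ^ 2)) * (2 * Real.exp 24 * (c₀ ^ 3)⁻¹) * (L : ℝ) ^ 5,
    (L : ℝ) / (4 * W ^ 2), 5, hγθ, hγθ1, by positivity, by positivity, ?_⟩
  intro F γ hFL hγ hγ₁ K hK p
  subst hFL
  have hγ1 : γ ≤ 1 := hγ₁.trans hγθ1
  haveI := isProbabilityMeasure_gibbsK F ℰp hγ.le K
  -- definitional bookkeeping of the `K`-th torus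
  have hPd : (F.P K).d = 3 := rfl
  have hPL : (F.P K).L = F.L := rfl
  have hj : 0 + 1 ≤ (F.P K).m + (F.P K).K := by show 0 + 1 ≤ F.m + K; have := F.hm; omega
  -- the threshold and the blamed size
  set θ := θBal F.L γ b₀ p₀ (K - 1) with hθdef
  have hθpos : 0 < θ := θBal_pos hL hγ hγ1 hb₀ p₀ (K - 1)
  set a := θ / W with hadef
  have ha : 0 < a := div_pos hθpos hW0
  have haθ : a ≤ θ := div_le_self hθpos.le hW1
  -- the blamed neighbourhood of `p` at level 0
  obtain ⟨S, hScard, hSdom⟩ := exists_blame_finset (n := Fin 2) hj p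
  rw [hPd, hPL] at hScard hSdom
  push_cast at hScard
  -- the guard of the (0.4) averaging at threshold `a`
  have hguard : (((3 + 2) * F.L : ℕ) : ℝ) ^ 2 / 4 * a < deltaSU (Fin 2) := by
    calc (((3 + 2) * F.L : ℕ) : ℝ) ^ 2 / 4 * a
        ≤ (((3 + 2) * F.L : ℕ) : ℝ) ^ 2 / 4 * (deltaSU (Fin 2) / (((3 + 2) * F.L : ℕ) : ℝ) ^ 2) :=
          mul_le_mul_of_nonneg_left (haθ.trans (hθ F.L hL γ hγ hγ₁ (K - 1))) (by positivity)
      _ = deltaSU (Fin 2) / 4 := by field_simp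
      _ < deltaSU (Fin 2) := by linarith [deltaSU_pos (n := Fin 2)]
  -- the event lies in the union of the blamed bare single-plaquette events
  have hsub : {U : GaugeField (F.P K) 0 (Matrix.specialUnitaryGroup (Fin 2) ℂ) |
        (∀ k, k < 1 → PlaqSmall (θBal F.L γ b₀ p₀ (K - k))
          (Averaging.iter (fun i => BlockAveraging.blockAvg (P := F.P K) (j := i) ℰp) k U)) ∧
        PlaqSmall (θBal F.L γ b₂ p₀ (K - 1)) (Averaging.iter (fun i => BlockAveraging.blockAvg (P := F.P K) (j := i) ℰp) 1 U) ∧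
        θBal F.L γ b₀ p₀ (K - 1) ≤ dist1 (GaugeField.plaqHol
          (Averaging.iter (fun i => BlockAveraging.blockAvg (P := F.P K) (j := i) ℰp) 1 U) p)} ⊆
      ⋃ q ∈ S, {U : GaugeField (F.P K) 0 (Matrix.specialUnitaryGroup (Fin 2) ℂ) | a ≤ dist1 (GaugeField.plaqHol U q)} := by
    intro U hU
    obtain ⟨-, -, hlarge⟩ := hU
    change θ ≤ dist1 (GaugeField.plaqHol (avgFun ℰp U) p) at hlarge
    by_contra hcon
    simp only [Set.mem_iUnion, Set.mem_setOf_eq, not_exists, not_le] at hcon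
    have hdom := hSdom U a ha.le hguard (fun q hq => (hcon q hq).le)
    have hlt : ((F.L : ℝ) ^ 2 + 6 * (((3 + 2) * F.L : ℕ) : ℝ) ^ 2) * a < θ := by
      have hWa : W * a = θ := by rw [hadef]; field_simp
      nlinarith
    exact absurd (hlarge.trans hdom) (not_le.mpr hlt)
  -- the bare tail at each blamed plaquette
  have hβ1 : 1 ≤ (F.scheme ℰp γ).β K := by
    show 1 ≤ (γ * (F.P K).eps)⁻¹
    have heps : (F.P K).eps = ((F.L : ℝ)⁻¹) ^ K := rfl
    rw [heps]
    have hx : 0 < γ * ((F.L : ℝ)⁻¹) ^ K := mul_pos hγ (pow_pos (inv_pos.2 (by exact_mod_cast hL0)) K)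
    have hx1 : γ * ((F.L : ℝ)⁻¹) ^ K ≤ 1 :=
      mul_le_one₀ hγ1 (pow_nonneg (inv_nonneg.2 (Nat.cast_nonneg _)) K)
        (pow_le_one₀ (inv_nonneg.2 (Nat.cast_nonneg _)) (inv_le_one_of_one_le₀ (by exact_mod_cast hL)))
    exact (one_le_inv₀ hx).2 hx1
  obtain ⟨hβL, hβθ⟩ := beta_height_one F hγ b₀ p₀ hK
  set β := (F.scheme ℰp γ).β K with hβdef
  set β' := (γ * ((F.L : ℝ)⁻¹) ^ (K - 1))⁻¹ with hβ'def
  set pg := B10.pFun b₀ p₀ (Real.sqrt (γ * ((F.L : ℝ)⁻¹) ^ (K - 1))) with hpgdef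
  have hβ'1 : 0 ≤ β' := by rw [hβ'def]; positivity
  have hcard3 : Fintype.card {q : Fin (F.P K).d × Fin (F.P K).d // q.1 < q.2} = 3 := by rw [hPd]; decide
  have hterm : ∀ q : Plaq (F.P K) 0,
      (gibbsK F ℰp γ K).real {U | a ≤ dist1 (GaugeField.plaqHol U q)} ≤
        2 * Real.exp 24 * (c₀ ^ 3)⁻¹ * ((F.L : ℝ) ^ 5 * β' ^ 5) * Real.exp (-((F.L : ℝ) / (4 * W ^ 2) * pg ^ 2)) := by
    intro q
    have h := htail (F.P K) β hβ1 a ha.le q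
    rw [gibbsK_eq]
    refine h.trans ?_
    rw [hcard3, hPd]
    -- the exponent: `β a²/4 = (L/(4W²))·p²`
    have hexp : β * a ^ 2 / (2 * (2 : ℕ)) = (F.L : ℝ) / (4 * W ^ 2) * pg ^ 2 := by
      rw [hadef, div_pow, show β * (θ ^ 2 / W ^ 2) / (2 * (2 : ℕ)) = β * θ ^ 2 / (4 * W ^ 2) by push_cast; ring, hβθ]
      ring
    rw [hexp]
    -- the prefactor: `(√β)^9 ≤ β^5 = L^5 β'^5`
    have hsqrt : Real.sqrt β ^ (3 * (2 ^ 2 - 1)) ≤ (F.L : ℝ) ^ 5 * β' ^ 5 := by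
      rw [show 3 * (2 ^ 2 - 1) = 9 by norm_num, ← mul_pow, ← hβL]
      have hβ0 : 0 ≤ β := zero_le_one.trans hβ1
      have hs1 : Real.sqrt β ≤ β := by
        calc Real.sqrt β ≤ Real.sqrt β * Real.sqrt β :=
              le_mul_of_one_le_right (Real.sqrt_nonneg _) (Real.one_le_sqrt.mpr hβ1)
          _ = β := Real.mul_self_sqrt hβ0
      calc Real.sqrt β ^ 9 = (Real.sqrt β * Real.sqrt β) ^ 4 * Real.sqrt β := by ring
        _ = β ^ 4 * Real.sqrt β := by rw [Real.mul_self_sqrt hβ0]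
        _ ≤ β ^ 4 * β := mul_le_mul_of_nonneg_left hs1 (pow_nonneg hβ0 4)
        _ = β ^ 5 := by ring
    have hK0 : 0 ≤ 2 * Real.exp (8 * (3 : ℕ)) * (c₀ ^ 3)⁻¹ := by positivity
    calc 2 * Real.exp (8 * (3 : ℕ)) * (c₀ ^ 3)⁻¹ * Real.sqrt β ^ (3 * (2 ^ 2 - 1)) * Real.exp (-((F.L : ℝ) / (4 * W ^ 2) * pg ^ 2))
        ≤ 2 * Real.exp (8 * (3 : ℕ)) * (c₀ ^ 3)⁻¹ * ((F.L : ℝ) ^ 5 * β' ^ 5) * Real.exp (-((F.L : ℝ) / (4 * W ^ 2) * pg ^ 2)) :=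
          mul_le_mul_of_nonneg_right (mul_le_mul_of_nonneg_left hsqrt hK0) (Real.exp_pos _).le
      _ = _ := by norm_num
  -- union bound
  have hScard' : (S.card : ℝ) ≤ (F.L : ℝ) ^ 2 + 5 * ((F.L : ℝ) ^ 3 * (3 : ℝ) ^ 2) := hScard
  have hT0 : 0 ≤ 2 * Real.exp 24 * (c₀ ^ 3)⁻¹ * ((F.L : ℝ) ^ 5 * β' ^ 5) * Real.exp (-((F.L : ℝ) / (4 * W ^ 2) * pg ^ 2)) := by
    positivity
  calc (gibbsK F ℰp γ K).real _
      ≤ (gibbsK F ℰp γ K).real (⋃ q ∈ S, {U : GaugeField (F.P K) 0 (Matrix.specialUnitaryGroup (Fin 2) ℂ) |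
          a ≤ dist1 (GaugeField.plaqHol U q)}) := measureReal_mono hsub (measure_ne_top _ _)
    _ ≤ ∑ q ∈ S, (gibbsK F ℰp γ K).real {U | a ≤ dist1 (GaugeField.plaqHol U q)} := measureReal_biUnion_finset_le S _
    _ ≤ ∑ _q ∈ S, 2 * Real.exp 24 * (c₀ ^ 3)⁻¹ * ((F.L : ℝ) ^ 5 * β' ^ 5) * Real.exp (-((F.L : ℝ) / (4 * W ^ 2) * pg ^ 2)) :=
        Finset.sum_le_sum fun q _ => hterm q
    _ = S.card * (2 * Real.exp 24 * (c₀ ^ 3)⁻¹ * ((F.L : ℝ) ^ 5 * β' ^ 5) * Real.exp (-((F.L : ℝ) / (4 * W ^ 2) * pg ^ 2))) := by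
        rw [Finset.sum_const, nsmul_eq_mul]
    _ ≤ ((F.L : ℝ) ^ 2 + 5 * ((F.L : ℝ) ^ 3 * (3 : ℝ) ^ 2)) *
          (2 * Real.exp 24 * (c₀ ^ 3)⁻¹ * ((F.L : ℝ) ^ 5 * β' ^ 5) * Real.exp (-((F.L : ℝ) / (4 * W ^ 2) * pg ^ 2))) :=
        mul_le_mul_of_nonneg_right hScard' hT0
    _ = ((F.L : ℝ) ^ 2 + 5 * ((F.L : ℝ) ^ 3 * (3 : ℝ) ^ 2)) * (2 * Real.exp 24 * (c₀ ^ 3)⁻¹) * (F.L : ℝ) ^ 5 * β' ^ 5 *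
          Real.exp (-((F.L : ℝ) / (4 * W ^ 2) * pg ^ 2)) := by ring

end T3


end Summit.QuantumFields.YangMills.Theorems.FirstExitWindow

end
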